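import Summits.QuantumFields.YangMills.Theorems.ColdStartUniversalityLatticeLangevinRegularFlowProgressive
import Summits.QuantumFields.YangMills.Theorems.ColdStartUniversalityColdStartSolutionsExistFlatFiltration
import HarnessLib

/-!
# Route `ColdStartUniversality` (brick «G4(iii)» of gauge covariance in law of the SZZ dynamics):
# ITÔ INTEGRALS OF BOUNDED OBSERVABLES ALONG THE REGULAR FLOW AGAINST EVERY COORDINATE OF THE FLAT NOISE

Helper file (seat `ym-line-csu-p1`, g10; `--supports stmt-QuantumFields-24809`).  The transfer of `IsSolution` to a
gauge-transformed solution driven by the ROTATED noise `W^R` (CSU lead memo §4, step (iii)) needs the CROSS integrals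
`∫ σ_{e,n}(Q_s)_{kl} dW^{e,n'}_s` for `n ≠ n'`, which the `IsSolution` structure does not record (it records `n = n'` only).
Along the regular flow of `exists_regularFlow` (measurability clause `hU`) they exist for EVERY bounded measurable observable
`φ` of the configuration and EVERY noise coordinate `i`:

* `sqErr_zero_ne_top_of_bounded` — a bounded integrand has finite `L²_loc(ds ⊗ P)` size;
* ★ `exists_isItoIntegral_comp_flow` — `∃ J, IsItoIntegral (φ ∘ U^x) (W^i) J hW.natFiltration P`, with `J` a square-integrable
  martingale (`isStronglyProgressive_comp_flow` + `exists_isItoIntegral_flatCoord`).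

THEOREMS ONLY, [folklore]; no crux or summit is proved; the Yang–Mills mass gap is NOT proved.
-/

set_option autoImplicit false

noncomputable section

namespace Summit.QuantumFields.YangMills.Theorems.ColdStartUniversality

open MeasureTheory ProbabilityTheory Filter
open scoped NNReal ENNReal
open Literature.Probability.Process Literature.MathematicalPhysics.QuantumFieldTheory

variable {Ω : Type*} {mΩ : MeasurableSpace Ω} {P : Measure Ω}

/-- A bounded integrand has finite `L²_loc(ds ⊗ P)` size: `sqErr H 0 P t ≤ C² · t < ∞` (no measurability needed). [folklore] -/
theorem sqErr_zero_ne_top_of_bounded [IsFiniteMeasure P] {H : ℝ≥0 → Ω → ℝ} {C : ℝ} (hC : ∀ s ω, |H s ω| ≤ C)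
    (t : ℝ≥0) : sqErr H 0 P t ≠ ⊤ := by
  have hpt : ∀ s ω, ENNReal.ofReal ((H s ω - (0 : ℝ≥0 → Ω → ℝ) s ω) ^ 2) ≤ ENNReal.ofReal (C ^ 2) := by
    intro s ω
    refine ENNReal.ofReal_le_ofReal ?_
    have h1 : (H s ω - (0 : ℝ≥0 → Ω → ℝ) s ω) = H s ω := by simp
    rw [h1, ← sq_abs, ← sq_abs C]
    have hC0 : 0 ≤ C := le_trans (abs_nonneg _) (hC s ω)
    rw [abs_of_nonneg hC0]
    exact pow_le_pow_left₀ (abs_nonneg _) (hC s ω) 2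
  have hinner : ∀ ω, (∫⁻ s in Set.Icc (0 : ℝ) t, ENNReal.ofReal ((H s.toNNReal ω - (0 : ℝ≥0 → Ω → ℝ) s.toNNReal ω) ^ 2)) ≤
      ENNReal.ofReal (C ^ 2) * volume (Set.Icc (0 : ℝ) t) := by
    intro ω
    calc (∫⁻ s in Set.Icc (0 : ℝ) t, ENNReal.ofReal ((H s.toNNReal ω - (0 : ℝ≥0 → Ω → ℝ) s.toNNReal ω) ^ 2))
        ≤ ∫⁻ _s in Set.Icc (0 : ℝ) t, ENNReal.ofReal (C ^ 2) := lintegral_mono fun s => hpt _ _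
      _ = ENNReal.ofReal (C ^ 2) * volume (Set.Icc (0 : ℝ) t) := by rw [lintegral_const, Measure.restrict_apply_univ]
  unfold sqErr
  refine ne_top_of_le_ne_top ?_ (lintegral_mono hinner)
  rw [lintegral_const]
  refine ENNReal.mul_ne_top (ENNReal.mul_ne_top ENNReal.ofReal_ne_top ?_) (measure_ne_top _ _)
  rw [Real.volume_Icc]
  exact ENNReal.ofReal_ne_top

variable {L : ℕ} [NeZero L]

/-- ★ **Itô integrals of bounded observables along the regular flow against every noise coordinate.**  For a flat
noise `W`, a solution flow `U` with the measurability clause of `exists_regularFlow`, a start `x`, a bounded measurable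
observable `φ` of the configuration and ANY coordinate `i` of the noise, the Itô integral `∫ φ(U^x_s) dW^i_s` exists w.r.t.
`hW.natFiltration`, as a square-integrable martingale. [folklore] -/
theorem exists_isItoIntegral_comp_flow [IsProbabilityMeasure P]
    {W : ℝ≥0 → Ω → (Edge 3 L × NoiseIdx 2 → ℝ)} (hW : IsFlatBrownian W P)
    {U : GaugeConfig 3 L (Matrix.specialUnitaryGroup (Fin 2) ℂ) → ℝ≥0 → Ω →
      GaugeConfig 3 L (Matrix.specialUnitaryGroup (Fin 2) ℂ)}
    (hU : ∀ i : ℝ≥0, Measurable[@Prod.instMeasurableSpace (Set.Iic i)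
        (GaugeConfig 3 L (Matrix.specialUnitaryGroup (Fin 2) ℂ) × Ω) inferInstance
        (@Prod.instMeasurableSpace (GaugeConfig 3 L (Matrix.specialUnitaryGroup (Fin 2) ℂ)) Ω inferInstance
          (hW.natFiltration i))]
      (fun q : Set.Iic i × (GaugeConfig 3 L (Matrix.specialUnitaryGroup (Fin 2) ℂ) × Ω) => U q.2.1 q.1 q.2.2))
    (x : GaugeConfig 3 L (Matrix.specialUnitaryGroup (Fin 2) ℂ))
    {φ : GaugeConfig 3 L (Matrix.specialUnitaryGroup (Fin 2) ℂ) → ℝ} (hφ : Measurable φ) {C : ℝ} (hC : ∀ v, |φ v| ≤ C)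
    (i : Edge 3 L × NoiseIdx 2) :
    ∃ J : ℝ≥0 → Ω → ℝ, IsItoIntegral (fun r ω => φ (U x r ω)) (fun t ω => W t ω i) J hW.natFiltration P ∧
      Martingale J hW.natFiltration P ∧ ∀ t, MemLp (J t) 2 P :=
  exists_isItoIntegral_flatCoord hW i (isStronglyProgressive_comp_flow hU x hφ)
    (sqErr_zero_ne_top_of_bounded (fun _ _ => hC _))

end Summit.QuantumFields.YangMills.Theorems.ColdStartUniversality

end
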